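import Summits.CriticalPhenomena.PercolationContinuityZ3.Theorems.PercHyperscalingGluingFreeBoxShatteringStubUniquenessGluing

/-!
# Aspect is density: `FreeBoxShattering ↔` aspect-free rarity of two unglued giants
# (crux `PercHyperscalingGluing.FreeBoxShattering`, stmt-CriticalPhenomena-4644, line `registered`)

A dictionary entry for the crux `F_r := |Λ_r|⁻¹ Σ_{x∈Λ_r} P_{p_c}(0 ↔ x inside Λ_r) → 0` of critical bond
percolation on `ℤ³`. The landed uniqueness-gluing equivalence (`stub_uniquenessGluing`,
`FreeBoxShattering ↔ TwoDensePiecesRare`) asks that two `δ|Λ_N|`-large free pieces of `Λ_N` NOT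
JOINED INSIDE `Λ_N` itself be asymptotically rare. A natural attempt to weaken the open stub is to
allow the gluing path a `K` times larger box ("aspect `K`"): two `δ|Λ_N|`-large free pieces of `Λ_N`,
rooted at `x, x'`, that are not joined inside `Λ_{KN}`.

**Theorem (`crux_iff_twoDenseFar`).** For every fixed aspect this is the SAME statement:
`FreeBoxShattering ↔ ∀ δ > 0, ∀ K ≥ 1, P_{p_c}(∃ x, x' ∈ Λ_N with |K_{Λ_N}(x)|, |K_{Λ_N}(x')| ≥ δ|Λ_N|,
x ↮ x' inside Λ_{KN}) → 0`.

`←` is the case `K = 1`. `→` (`real_twoDenseFar_le`): the in-box cluster only grows with the box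
(`openConnIn_mono`) and `δ|Λ_N| = δ(2N+1)³ ≥ (δ/K³)(2KN+1)³ = (δ/K³)|Λ_{KN}|` for `K ≥ 1`, so the
aspect-`K` event at scale `N` and density `δ` is contained in the aspect-`1` event at scale `KN` and
density `δ/K³`, whose probability vanishes by `TwoDensePiecesRare` along `N ↦ KN → ∞`.

Consequence for planning (recorded in `Cruxes/FreeBoxShattering/Lines/registered.dead.md` §5):
feeding the uniqueness-gluing engine at aspect `K` instead of `2` asks for the same open stub at
density `δ/K³`; no aspect gives a weaker hypothesis.

## References
* T. Hutchcroft, arXiv:2202.07634, p. 5 (the unsourced "folklore" sentence the crux formalises);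
  P. Easo, T. Hutchcroft, arXiv:2112.12778, Rem. 1.4 (critical torus giants: open);
  G. Grimmett, *Percolation* (1999), §1.6 (monotonicity of `{x ↔ y in S}` in `S`).
-/

noncomputable section
namespace Summit.CriticalPhenomena.PercolationContinuityZ3.Theorems.FreeBoxShattering.AspectFree

open MeasureTheory Filter
open Literature.Probability.Percolation Literature.Probability.LatticeModels
open scoped Topology Classical
open Summit.CriticalPhenomena.PercolationContinuityZ3.Theses.PercHyperscalingGluing (FreeBoxShattering)

local notation3 "μc" => bondPercolation (zdGraph 3) (criticalProbI 3)
local notation3 "piece⟦" Λ ", " ω ", " x "⟧" =>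
  ((Finset.filter (fun v => (ω : BondConfig (Site 3)) ∈
    openConnIn (↑(Λ : Finset (Site 3)) : Set (Site 3)) x v) Λ).card : ℝ)
/-- `twoDense⟦Λ, θ⟧`: two vertices of `Λ` not joined inside `Λ`, both with free pieces of `≥ θ`
vertices (verbatim the event of `TwoDensePiecesRare`). -/
local notation3 "twoDense⟦" Λ ", " θ "⟧" =>
  {ω : BondConfig (Site 3) | ∃ x ∈ (Λ : Finset (Site 3)), ∃ x' ∈ Λ,
    ω ∉ openConnIn (↑Λ : Set (Site 3)) x x' ∧ (θ : ℝ) ≤ piece⟦Λ, ω, x⟧ ∧ (θ : ℝ) ≤ piece⟦Λ, ω, x'⟧}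
/-- `twoDenseFar⟦N, K, θ⟧`: two vertices of `Λ_N` whose `Λ_N`-pieces have `≥ θ` vertices and
which are not joined even inside the larger box `Λ_{KN}` (aspect `K`). -/
local notation3 "twoDenseFar⟦" N ", " K ", " θ "⟧" =>
  {ω : BondConfig (Site 3) | ∃ x ∈ box 3 N, ∃ x' ∈ box 3 N,
    ω ∉ openConnIn (↑(box 3 (K * N)) : Set (Site 3)) x x' ∧
      (θ : ℝ) ≤ piece⟦box 3 N, ω, x⟧ ∧ (θ : ℝ) ≤ piece⟦box 3 N, ω, x'⟧}

/-- Free pieces grow with the box: `|K_Λ(x)| ≤ |K_{Λ'}(x)|` for `Λ ⊆ Λ'`. [folklore] -/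
theorem piece_mono {Λ Λ' : Finset (Site 3)} (h : Λ ⊆ Λ') (ω : BondConfig (Site 3)) (x : Site 3) :
    piece⟦Λ, ω, x⟧ ≤ piece⟦Λ', ω, x⟧ := by
  exact_mod_cast Finset.card_le_card fun v hv => by
    rw [Finset.mem_filter] at hv ⊢
    exact ⟨h hv.1, openConnIn_mono (Finset.coe_subset.2 h) x v hv.2⟩

/-- Volume bookkeeping: `(δ/K³)|Λ_{KN}| ≤ δ|Λ_N|` for `K ≥ 1`, `δ ≥ 0`
(`(2KN+1)³ ≤ K³(2N+1)³`). [folklore] -/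
theorem density_rescale {δ : ℝ} (hδ : 0 ≤ δ) {K : ℕ} (hK : 1 ≤ K) (N : ℕ) :
    δ / (K : ℝ) ^ 3 * ((box 3 (K * N)).card : ℝ) ≤ δ * ((box 3 N).card : ℝ) := by
  rw [card_box, card_box]
  push_cast
  have hK' : (1 : ℝ) ≤ K := by exact_mod_cast hK
  have hK0 : (0 : ℝ) < (K : ℝ) ^ 3 := by positivity
  have h1 : (2 * ((K : ℝ) * N) + 1) ^ 3 ≤ ((K : ℝ) * (2 * (N : ℝ) + 1)) ^ 3 := by
    gcongr; nlinarith [Nat.cast_nonneg (α := ℝ) N]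
  rw [div_mul_eq_mul_div, div_le_iff₀ hK0]
  calc δ * (2 * ((K : ℝ) * N) + 1) ^ 3 ≤ δ * ((K : ℝ) * (2 * (N : ℝ) + 1)) ^ 3 :=
        mul_le_mul_of_nonneg_left h1 hδ
    _ = δ * (2 * (N : ℝ) + 1) ^ 3 * (K : ℝ) ^ 3 := by ring

/-- **Aspect `K` at scale `N` is aspect `1` at scale `KN`, density divided by `K³`.**
`twoDenseFar⟦N, K, δ|Λ_N|⟧ ⊆ twoDense⟦Λ_{KN}, (δ/K³)|Λ_{KN}|⟧` for `K ≥ 1`. [folklore] -/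
theorem twoDenseFar_subset {δ : ℝ} (hδ : 0 ≤ δ) {K : ℕ} (hK : 1 ≤ K) (N : ℕ) :
    twoDenseFar⟦N, K, δ * ((box 3 N).card : ℝ)⟧ ⊆
      twoDense⟦box 3 (K * N), δ / (K : ℝ) ^ 3 * ((box 3 (K * N)).card : ℝ)⟧ := by
  have hsub : box 3 N ⊆ box 3 (K * N) := box_mono 3 (Nat.le_mul_of_pos_left N hK)
  rintro ω ⟨x, hx, x', hx', hnot, h1, h2⟩
  refine ⟨x, hsub hx, x', hsub hx', hnot, ?_, ?_⟩
  · exact (density_rescale hδ hK N).trans (h1.trans (piece_mono hsub ω x))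
  · exact (density_rescale hδ hK N).trans (h2.trans (piece_mono hsub ω x'))

/-- The aspect-`K` two-giant probability is bounded by the aspect-`1` one at scale `KN` and density
`δ/K³`. [folklore] -/
theorem real_twoDenseFar_le {δ : ℝ} (hδ : 0 ≤ δ) {K : ℕ} (hK : 1 ≤ K) (N : ℕ) :
    (μc).real twoDenseFar⟦N, K, δ * ((box 3 N).card : ℝ)⟧ ≤
      (μc).real twoDense⟦box 3 (K * N), δ / (K : ℝ) ^ 3 * ((box 3 (K * N)).card : ℝ)⟧ :=
  measureReal_mono (twoDenseFar_subset hδ hK N)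

/-- **`TwoDensePiecesRare` is aspect-free.** If two unglued `δ`-dense free pieces of `Λ_N` are
asymptotically rare for every `δ > 0` (gluing inside `Λ_N`), then for every `δ > 0` and every aspect
`K ≥ 1` two `δ|Λ_N|`-large free pieces of `Λ_N` not joined inside `Λ_{KN}` are asymptotically rare.
[folklore] -/
theorem tendsto_twoDenseFar_of_twoDensePiecesRare
    (hU : ∀ δ : ℝ, 0 < δ → Tendsto (fun N : ℕ => (μc).real
      twoDense⟦box 3 N, δ * ((box 3 N).card : ℝ)⟧) atTop (𝓝 0))
    {δ : ℝ} (hδ : 0 < δ) {K : ℕ} (hK : 1 ≤ K) :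
    Tendsto (fun N : ℕ => (μc).real twoDenseFar⟦N, K, δ * ((box 3 N).card : ℝ)⟧) atTop (𝓝 0) := by
  have hKN : Tendsto (fun N : ℕ => K * N) atTop atTop :=
    tendsto_atTop_mono (fun N => Nat.le_mul_of_pos_left N hK) tendsto_id
  have hlim := (hU (δ / (K : ℝ) ^ 3) (by positivity)).comp hKN
  exact squeeze_zero (fun N => measureReal_nonneg) (fun N => real_twoDenseFar_le hδ.le hK N) hlim

/-- **`crux_iff_twoDenseFar` — aspect is density.** The crux `FreeBoxShattering` holds iff for
every density `δ > 0` AND every aspect `K ≥ 1`, the `P_{p_c}`-probability that `Λ_N` contains two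
vertices with `Λ_N`-pieces of `≥ δ|Λ_N|` vertices which are not joined inside `Λ_{KN}` tends to `0`.
(`→`: `stub_uniquenessGluing` then `tendsto_twoDenseFar_of_twoDensePiecesRare`; `←`: `K = 1` and
`stub_uniquenessGluing`.) So allowing the gluing path a `K` times larger box does not weaken the
open stub of the line: it is the same statement at density `δ/K³`. [folklore] -/
theorem crux_iff_twoDenseFar :
    Summit.CriticalPhenomena.PercolationContinuityZ3.Theses.PercHyperscalingGluing.FreeBoxShattering ↔
      ∀ δ : ℝ, 0 < δ → ∀ K : ℕ, 1 ≤ K → Tendsto (fun N : ℕ =>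
        (bondPercolation (zdGraph 3) (criticalProbI 3)).real
          {ω | ∃ x ∈ box 3 N, ∃ x' ∈ box 3 N, ω ∉ openConnIn ↑(box 3 (K * N)) x x' ∧
            δ * ((box 3 N).card : ℝ) ≤
              (((box 3 N).filter fun v => ω ∈ openConnIn ↑(box 3 N) x v).card : ℝ) ∧
            δ * ((box 3 N).card : ℝ) ≤
              (((box 3 N).filter fun v => ω ∈ openConnIn ↑(box 3 N) x' v).card : ℝ)})
        atTop (𝓝 0) := by
  constructor
  · intro hS δ hδ K hK
    exact tendsto_twoDenseFar_of_twoDensePiecesRare (stub_uniquenessGluing.1 hS) hδ hK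
  · intro h
    refine stub_uniquenessGluing.2 fun δ hδ => ?_
    simpa only [one_mul] using h δ hδ 1 le_rfl

end Summit.CriticalPhenomena.PercolationContinuityZ3.Theorems.FreeBoxShattering.AspectFree

end
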